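import Summits.RiemannHypothesis.RiemannHypothesis.Theorems.SignConeOscCoherentCoreStubTransfer

/-!
# The unconditional off-line defect ledger on the zero side
(route `SignCone`, item stmt-RiemannHypothesis-18013 `OscCoherentCore`, line `Sketch`; `--supports`)

The UNCONDITIONAL heart of the line's transfer, recorded as a theorem of its own (no hypothesis on the zeros of `ζ`):
for every Weil test `g` supported in `[-a, a]` (`a ≥ 1`), `k = g ⋆ g̃`, and every height `T`,

  `Re Σ_{ρ ∈ weilZeroIndex T} m(ρ) k̂(ρ) ≥ -(E(a)/4π) ∫ ‖ĝ(1/2+iξ)‖² · B_T(ξ) dξ`,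
  `B_T(ξ) := Σ_{ρ ∈ weilZeroIndex T} m(ρ) (Re ρ - 1/2)² / (1 + (Im ρ - ξ)²)`, `E(a) = 200 (2a+1)³ cosh(a + 1/2)`

(`re_weilZeroSidePartial_ge_neg_spectralDefect`). The off-line zeros act on the test ONLY through the
Cauchy-smoothed off-line second moment `B_T` seen by the spectral measure `‖ĝ‖² dξ` (total mass `2π‖g‖₂²`):
every zero is projected onto the critical line (free positivity `k̂(1/2+iγ) = |ĝ|² ≥ 0`), and the defect kernel
`2cosh(δu) - 2` is paid in the currency `m δ²`. Consequences in the tree: with the window law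
`B_T ≤ κ(a)(4a+4)` (`stub_windowSum`) this is `stub_transfer`; a test whose spectral mass avoids the heights where
`B_T` is large satisfies the unit-slack inequality unconditionally (exceptional-set form, not spelled out here).
-/

noncomputable section

-- `Summit.RiemannHypothesis.RiemannHypothesis.…` repeats a namespace component by design (D-0017 layout).
set_option linter.dupNamespace false

open scoped BigOperators ComplexConjugate Real
open Complex MeasureTheory Set Filter

namespace Summit.RiemannHypothesis.RiemannHypothesis.Theorems.OscCoherentCore

open Literature.NumberTheory.LFunctions

/-- **The off-line defect ledger (unconditional).** For a Weil test `g` supported in `[-a, a]`, `a ≥ 1`, and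
every `T`: `-(E(a)/4π) ∫ ‖ĝ(1/2+iξ)‖² B_T(ξ) dξ ≤ Re Σ_{ρ ∈ weilZeroIndex T} m(ρ) (g ⋆ g̃)^(ρ)` with
`B_T(ξ) = Σ_{ρ ∈ weilZeroIndex T} m(ρ)(Re ρ - 1/2)²/(1 + (Im ρ - ξ)²)` and `E(a) = 200(2a+1)³cosh(a+1/2)`
(sum of the per-zero bounds `zeroTerm_re_ge`; finite sum and integral exchanged). [folklore] -/
theorem re_weilZeroSidePartial_ge_neg_spectralDefect {a : ℝ} (ha : 1 ≤ a) {g : ℝ → ℂ} (hg : IsWeilTest g)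
    (hsupp : tsupport g ⊆ Icc (-a) a) (T : ℝ) :
    -(200 * (2 * a + 1) ^ 3 * Real.cosh (a + 1 / 2) / (4 * π)) *
        ∫ ξ : ℝ, ‖weilMellin g (1 / 2 + ξ * I)‖ ^ 2 *
          ∑ᶠ ρ ∈ weilZeroIndex T,
            (riemannZetaZeroOrder ρ : ℝ) * (ρ.re - 1 / 2) ^ 2 / (1 + (ρ.im - ξ) ^ 2) ≤
      (weilZeroSidePartial (weilConv g (weilReflect g)) T).re := by
  have hfin := weilZeroIndex_finite T
  have hmem : ∀ ρ ∈ hfin.toFinset, riemannZeta ρ = 0 ∧ 0 ≤ ρ.re ∧ ρ.re ≤ 1 ∧ ρ.im ≠ 0 ∧ |ρ.im| ≤ T :=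
    fun ρ hρ => by simpa [weilZeroIndex] using hρ
  have hre : (weilZeroSidePartial (weilConv g (weilReflect g)) T).re =
      ∑ ρ ∈ hfin.toFinset, (riemannZetaZeroOrder ρ : ℝ) *
        (weilMellin (weilConv g (weilReflect g)) ρ).re := by
    unfold weilZeroSidePartial
    rw [finsum_mem_eq_finite_toFinset_sum _ hfin, Complex.re_sum]
    refine Finset.sum_congr rfl fun ρ _ => ?_
    rw [← Complex.ofReal_intCast, Complex.re_ofReal_mul]
  rw [hre]
  have hInt : ∀ ρ ∈ hfin.toFinset, Integrable fun ξ : ℝ => ‖weilMellin g (1 / 2 + ξ * I)‖ ^ 2 *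
      ((riemannZetaZeroOrder ρ : ℝ) * (ρ.re - 1 / 2) ^ 2 / (1 + (ρ.im - ξ) ^ 2)) := by
    intro ρ hρ
    obtain ⟨-, -, -, him, -⟩ := hmem ρ hρ
    have hne : ρ ≠ 1 := by
      rintro rfl
      simp at him
    have hm0 : (0 : ℝ) ≤ riemannZetaZeroOrder ρ := by exact_mod_cast riemannZetaZeroOrder_nonneg hne
    exact integrable_norm_sq_weilMellin_mul_cauchyWeight hg (by positivity) ρ.im
  have hfs : (fun ξ : ℝ => ‖weilMellin g (1 / 2 + ξ * I)‖ ^ 2 *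
      ∑ᶠ ρ ∈ weilZeroIndex T, (riemannZetaZeroOrder ρ : ℝ) * (ρ.re - 1 / 2) ^ 2 / (1 + (ρ.im - ξ) ^ 2)) =
      fun ξ : ℝ => ∑ ρ ∈ hfin.toFinset, ‖weilMellin g (1 / 2 + ξ * I)‖ ^ 2 *
        ((riemannZetaZeroOrder ρ : ℝ) * (ρ.re - 1 / 2) ^ 2 / (1 + (ρ.im - ξ) ^ 2)) := by
    funext ξ
    rw [finsum_mem_eq_finite_toFinset_sum _ hfin, Finset.mul_sum]
  calc -(200 * (2 * a + 1) ^ 3 * Real.cosh (a + 1 / 2) / (4 * π)) *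
        ∫ ξ : ℝ, ‖weilMellin g (1 / 2 + ξ * I)‖ ^ 2 *
          ∑ᶠ ρ ∈ weilZeroIndex T,
            (riemannZetaZeroOrder ρ : ℝ) * (ρ.re - 1 / 2) ^ 2 / (1 + (ρ.im - ξ) ^ 2)
      = ∑ ρ ∈ hfin.toFinset, -(200 * (2 * a + 1) ^ 3 * Real.cosh (a + 1 / 2) / (4 * π)) *
          ∫ ξ : ℝ, ‖weilMellin g (1 / 2 + ξ * I)‖ ^ 2 *
            ((riemannZetaZeroOrder ρ : ℝ) * (ρ.re - 1 / 2) ^ 2 / (1 + (ρ.im - ξ) ^ 2)) := by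
        rw [hfs, integral_finsetSum _ hInt, Finset.mul_sum]
    _ ≤ ∑ ρ ∈ hfin.toFinset, (riemannZetaZeroOrder ρ : ℝ) *
          (weilMellin (weilConv g (weilReflect g)) ρ).re := by
        refine Finset.sum_le_sum fun ρ hρ => ?_
        obtain ⟨-, h0, h1, him, -⟩ := hmem ρ hρ
        exact zeroTerm_re_ge ha hg hsupp h0 h1 him

/-- STUB (registered `stub_spectralLedger`, uncurried form of `re_weilZeroSidePartial_ge_neg_spectralDefect`):
the unconditional off-line defect ledger on the zero side. [folklore] -/
theorem stub_spectralLedger : ∀ a : ℝ, 1 ≤ a → ∀ g : ℝ → ℂ, Literature.NumberTheory.LFunctions.IsWeilTest g → tsupport g ⊆ Set.Icc (-a) a → ∀ T : ℝ, -(200 * (2 * a + 1) ^ 3 * Real.cosh (a + 1 / 2) / (4 * Real.pi)) * (∫ ξ : ℝ, ‖Literature.NumberTheory.LFunctions.weilMellin g (1 / 2 + ξ * Complex.I)‖ ^ 2 * ∑ᶠ ρ ∈ Literature.NumberTheory.LFunctions.weilZeroIndex T, (Literature.NumberTheory.LFunctions.riemannZetaZeroOrder ρ : ℝ) * (ρ.re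 - 1 / 2) ^ 2 / (1 + (ρ.im - ξ) ^ 2)) ≤ (Literature.NumberTheory.LFunctions.weilZeroSidePartial (Literature.NumberTheory.LFunctions.weilConv g (Literature.NumberTheory.LFunctions.weilReflect g)) T).re :=
  fun _ ha _ hg hsupp T => re_weilZeroSidePartial_ge_neg_spectralDefect ha hg hsupp T

end Summit.RiemannHypothesis.RiemannHypothesis.Theorems.OscCoherentCore

end
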